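import Literature.NumberTheory.EllipticCurves.ModularPolynomialLevelSevenPoints
import HarnessLib

/-!
# Double roots of the level-7 fibre: the derivative relations `∂Φ₇/∂X (x₀, y₀) = 0` at the CM nodes (discriminants `−12, −19, −27` and `−20, −24, −40`)

certified instances and evidence bearing on the general Hodge conjecture; no claim.

Topic `NumberTheory/EllipticCurves` (complex multiplication).  Theorem-only file (no definition, no named fact; D-0026), sequel to
`ModularPolynomialLevelSevenFibreZero.lean` (movers) and `ModularPolynomialLevelSevenPoints.lean` (the simple cosets), in the tree's
vocabulary `intModularPolynomial 7`, `modularPolyAt`, `jConj`, `heegnerTau`, `formJ`, `divPoint 7 k`; `Fact (Nat.Prime 7)` an instance ARGUMENT.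

## PRINTED inputs
* the fibre `Φ_p(X, j(τ)) = ∏_{σ ∈ C(p)} (X − j(στ))` [Cox2013, §11.B (11.14)–(11.15), PDF p. 239] (tree: `map_kleinJ_modularPolynomial`,
  `modularPolyAt p τ = ∏_i (X − C (jConj i τ))`), `σ ∈ C(p)` ↔ index-`p` sublattices [Cox2013, §11.B Lemma 11.24];
* `j(τ_Q)` is a class invariant [Cox2013, §11.A Thm. 11.2] (tree: `formJ_eq_formJ_act`); the class-number-one values [Cox2013, §12.C (12.20)]
  (tree: `GrossZagier1985.kleinJ_heegnerTau_neg_twelve/neg_nineteen/neg_twentySeven`).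

## Results (OURS: the device and the bookkeeping; each a kernel-checked consequence of the printed inputs)
§1 THE DEVICE (generic prime level `p`): if two DISTINCT cosets `σ₁ ≠ σ₂` of `τ` have the same modulus `j(σ₁τ) = j(σ₂τ) = a`, the
fibre polynomial `∏_σ (X − j(στ))` has the factor `(X − a)²`, hence `∂Φ_p/∂X (a, j(τ)) = 0` (`derivative_modularPolyAt_eval_eq_zero`;
with integer cosets `0 ≤ k₁ < k₂ < p`: `derivative_fibre_eval_eq_zero_of_divPoint`).  This happens exactly when `p` SPLITS in the CM order of `τ` (`p𝒪 = 𝔭𝔭̄`): the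
two sublattices `𝔭𝔞`, `𝔭̄𝔞` have moduli `j([𝔭𝔞]) = j([𝔭̄𝔞])` iff `[𝔭]² = 1`, always true in class number ≤ 2.
§2 `D = −12, −19, −27` (class number one; cosets recorded in `ModularPolynomialLevelSevenPoints.lean`): `∂Φ₇/∂X (j, j) = 0` at
`j = 54000, −884736, −12288000`.
§3 `D = −20, −40` (`7` split, `𝔭₇` non-principal): from each of the two classes the two `𝔭₇`-cosets land in the OTHER class — four
coset lemmas, the value relation both ways and the derivative relation both ways; `D = −24` (`7 = N(1 + √−6)`, `𝔭₇` principal): the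
two cosets land in the SAME class — a double DIAGONAL zero at each of the two (irrational, conjugate) moduli.
The split bases `−48, −52` (same shape) and the value relation at `−75` are in the sibling file `ModularPolynomialLevelSevenNodesB.lean`.
With the fibre over `0` and the simple relations of `ModularPolynomialLevelSevenPoints.lean` these are 27 independent linear conditions on the
27 unknown coefficients of `Φ₇` (lit note PHI7-SCOPE); the solve is left to the sequels.

## References
* [Cox2013] D. A. Cox, *Primes of the form x² + ny²*, 2nd ed., Wiley (2013): §11.B (11.14)–(11.15) (p. 239), Lemma 11.24 (p. 243),
  §11.A Thm. 11.2, §7.B (7.8)–(7.9), §12.C table (12.20).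
-/

noncomputable section

open Complex Polynomial
open UpperHalfPlane hiding I
open scoped MatrixGroups

namespace Literature.NumberTheory.EllipticCurves

open ModularForms
open Literature.NumberTheory.QuadraticFields.Quadratic (BinQF)

section Device

variable {p : ℕ} [Fact (Nat.Prime p)]

/-- **Two equal conjugates make a double root of the fibre**: if `j(σ₁τ) = j(σ₂τ)` for two distinct `σ₁ ≠ σ₂ ∈ C(p)`, then
`∂/∂X ∏_{σ}(X − j(στ))` vanishes at that value. [cite: Cox2013, §11.B (11.14)–(11.15)] -/
theorem derivative_modularPolyAt_eval_eq_zero {τ : ℍ} {i₁ i₂ : Option (ZMod p)} (hne : i₁ ≠ i₂)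
    (h : jConj i₁ τ = jConj i₂ τ) : (derivative (modularPolyAt p τ)).eval (jConj i₁ τ) = 0 := by
  unfold modularPolyAt
  rw [← Finset.mul_prod_erase Finset.univ _ (Finset.mem_univ i₁)]
  have hi₂ : i₂ ∈ Finset.univ.erase i₁ := Finset.mem_erase.mpr ⟨hne.symm, Finset.mem_univ _⟩
  rw [← Finset.mul_prod_erase _ _ hi₂, ← h]
  simp only [derivative_mul, derivative_sub, derivative_X, derivative_C, sub_zero, one_mul, eval_add, eval_mul,
    eval_sub, eval_X, eval_C, sub_self, zero_mul, add_zero]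

/-- Distinct residues: `0 ≤ k₁ < k₂ < p` gives `k₁ ≢ k₂ (mod p)`. [folklore] -/
private theorem intCast_zmod_ne_of_lt {k₁ k₂ : ℤ} (h0 : 0 ≤ k₁) (h12 : k₁ < k₂) (h2p : k₂ < p) :
    (k₁ : ZMod p) ≠ (k₂ : ZMod p) := by
  intro heq
  have hd : (p : ℤ) ∣ k₂ - k₁ := (ZMod.intCast_eq_intCast_iff_dvd_sub k₁ k₂ p).mp heq
  obtain ⟨c, hc⟩ := hd
  have hp : (0 : ℤ) < p := by exact_mod_cast (Fact.out : p.Prime).pos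
  have hc0 : 0 < c := by nlinarith
  have hc1 : c < 1 := by nlinarith
  omega

/-- The device for the integer modular equation, cosets given as integers: if `j((τ+k₁)/p) = j((τ+k₂)/p)` with `0 ≤ k₁ < k₂ < p`,
then `∂Φ_p/∂X (j((τ+k₁)/p), j(τ)) = 0`. [cite: Cox2013, §11.B (11.14)–(11.15)] -/
theorem derivative_fibre_eval_eq_zero_of_divPoint {τ : ℍ} {k₁ k₂ : ℤ} (h0 : 0 ≤ k₁) (h12 : k₁ < k₂) (h2p : k₂ < p)
    (h : kleinJ (divPoint p k₁ τ) = kleinJ (divPoint p k₂ τ)) :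
    (derivative (((intModularPolynomial p).map (mapRingHom (Int.castRingHom ℂ))).map (evalRingHom (kleinJ τ)))).eval
      (kleinJ (divPoint p k₁ τ)) = 0 := by
  have hne : (some (k₁ : ZMod p) : Option (ZMod p)) ≠ some (k₂ : ZMod p) :=
    fun e => intCast_zmod_ne_of_lt h0 h12 h2p (Option.some.inj e)
  have h₁ : jConj (some (k₁ : ZMod p)) τ = kleinJ (divPoint p k₁ τ) := jConj_some_eq_of_intCast_eq rfl τ
  have h₂ : jConj (some (k₂ : ZMod p)) τ = kleinJ (divPoint p k₂ τ) := jConj_some_eq_of_intCast_eq rfl τ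
  have hd := derivative_modularPolyAt_eval_eq_zero hne (h₁.trans (h.trans h₂.symm))
  rw [h₁] at hd
  rw [map_intModularPolynomial, map_kleinJ_modularPolynomial]
  exact hd

end Device

namespace ModularPolynomialSeven

variable [Fact (Nat.Prime 7)]

/-! ### §2 The three class-number-one nodes (cosets from `ModularPolynomialLevelSevenPoints.lean`) -/

/-- **`∂Φ₇/∂X (54000, 54000) = 0`** (`D = -12`, class number one, `7` split): the cosets `k = 2, 5` of `τ_{(1,0,3)}` are the two
endomorphisms of degree `7`, so `j = 54000` is a DOUBLE diagonal zero. [cite: Cox2013, §11.B (11.14)–(11.15), Lemma 11.24, §12.C (12.20)] -/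
theorem drel_neg12 : (derivative (((intModularPolynomial 7).map (mapRingHom (Int.castRingHom ℂ))).map
    (evalRingHom (54000 : ℂ)))).eval (54000 : ℂ) = 0 := by
  have h := derivative_fibre_eval_eq_zero_of_divPoint (p := 7) (k₁ := 2) (k₂ := 5) (τ := heegnerTau (1, 0, 3))
    (by norm_num) (by norm_num) (by norm_num) (conj_2_neg12.trans conj_5_neg12.symm)
  rwa [conj_2_neg12, GrossZagier1985.kleinJ_heegnerTau_neg_twelve] at h

/-- **`∂Φ₇/∂X (-884736, -884736) = 0`** (`D = -19`, class number one, `7` split): the cosets `k = 2, 6` of `τ_{(1,1,5)}` are the two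
endomorphisms of degree `7`, so `j = -884736` is a DOUBLE diagonal zero. [cite: Cox2013, §11.B (11.14)–(11.15), Lemma 11.24, §12.C (12.20)] -/
theorem drel_neg19 : (derivative (((intModularPolynomial 7).map (mapRingHom (Int.castRingHom ℂ))).map
    (evalRingHom (-884736 : ℂ)))).eval (-884736 : ℂ) = 0 := by
  have h := derivative_fibre_eval_eq_zero_of_divPoint (p := 7) (k₁ := 2) (k₂ := 6) (τ := heegnerTau (1, 1, 5))
    (by norm_num) (by norm_num) (by norm_num) (conj_2_neg19.trans conj_6_neg19.symm)
  rwa [conj_2_neg19, GrossZagier1985.kleinJ_heegnerTau_neg_nineteen] at h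

/-- **`∂Φ₇/∂X (-12288000, -12288000) = 0`** (`D = -27`, class number one, `7` split): the cosets `k = 0, 1` of `τ_{(1,1,7)}` are the two
endomorphisms of degree `7`, so `j = -12288000` is a DOUBLE diagonal zero. [cite: Cox2013, §11.B (11.14)–(11.15), Lemma 11.24, §12.C (12.20)] -/
theorem drel_neg27 : (derivative (((intModularPolynomial 7).map (mapRingHom (Int.castRingHom ℂ))).map
    (evalRingHom (-12288000 : ℂ)))).eval (-12288000 : ℂ) = 0 := by
  have h := derivative_fibre_eval_eq_zero_of_divPoint (p := 7) (k₁ := 0) (k₂ := 1) (τ := heegnerTau (1, 1, 7))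
    (by norm_num) (by norm_num) (by norm_num) (conj_0_neg27.trans conj_1_neg27.symm)
  rwa [conj_0_neg27, GrossZagier1985.kleinJ_heegnerTau_neg_twentySeven] at h

/-! ### §3 The split class-number-two bases `−20`, `−24`, `−40` -/

/-! ### `D = -20`: forms `(1,0,5)` (principal) and `(2,2,3)` -/

/-- `j((τ_{(1,0,5)} + 3)/7) = j(τ_{(49,-42,14)}) = j(τ_{(7,-6,2)}) = j(τ_{(2,2,3)})` (`D = -20`).
[cite: Cox2013, §11.B Lemma 11.24 and §11.A Thm. 11.2] -/
theorem conj_3_neg20 : kleinJ (divPoint 7 3 (heegnerTau (1, 0, 5))) = formJ (2, 2, 3) := by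
  have h := divPoint_seven_heegnerTau_of_pos (a := 1) (b := 0) (c := 5) one_pos (by norm_num) 3
  norm_num at h
  have h7 := heegnerTau_seven_mul (a := 7) (b := -6) (c := 2) (by norm_num) (by norm_num)
  norm_num at h7
  rw [h, h7, ← formJ_eq_kleinJ]
  have e := formJ_eq_formJ_act ⟨7, -6, 2⟩ (by norm_num) (by norm_num [BinQF.disc]) (p := 0) (q := -1)
    (r := 1) (s := -1) (by norm_num)
  simpa [BinQF.act] using e

/-- `j((τ_{(1,0,5)} + 4)/7) = j(τ_{(49,-56,21)}) = j(τ_{(7,-8,3)}) = j(τ_{(2,2,3)})` (`D = -20`).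
[cite: Cox2013, §11.B Lemma 11.24 and §11.A Thm. 11.2] -/
theorem conj_4_neg20 : kleinJ (divPoint 7 4 (heegnerTau (1, 0, 5))) = formJ (2, 2, 3) := by
  have h := divPoint_seven_heegnerTau_of_pos (a := 1) (b := 0) (c := 5) one_pos (by norm_num) 4
  norm_num at h
  have h7 := heegnerTau_seven_mul (a := 7) (b := -8) (c := 3) (by norm_num) (by norm_num)
  norm_num at h7
  rw [h, h7, ← formJ_eq_kleinJ]
  have e := formJ_eq_formJ_act ⟨7, -8, 3⟩ (by norm_num) (by norm_num [BinQF.disc]) (p := -1) (q := -1)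
    (r := -1) (s := -2) (by norm_num)
  simpa [BinQF.act] using e

/-- `j((τ_{(2,2,3)} + 2)/7) = j(τ_{(98,-42,7)}) = j(τ_{(14,-6,1)}) = j(τ_{(1,0,5)})` (`D = -20`).
[cite: Cox2013, §11.B Lemma 11.24 and §11.A Thm. 11.2] -/
theorem conj_2_neg20' : kleinJ (divPoint 7 2 (heegnerTau (2, 2, 3))) = formJ (1, 0, 5) := by
  have h := divPoint_seven_heegnerTau_of_pos (a := 2) (b := 2) (c := 3) (by norm_num) (by norm_num) 2
  norm_num at h
  have h7 := heegnerTau_seven_mul (a := 14) (b := -6) (c := 1) (by norm_num) (by norm_num)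
  norm_num at h7
  rw [h, h7, ← formJ_eq_kleinJ]
  have e := formJ_eq_formJ_act ⟨14, -6, 1⟩ (by norm_num) (by norm_num [BinQF.disc]) (p := 0) (q := -1)
    (r := 1) (s := -3) (by norm_num)
  simpa [BinQF.act] using e

/-- `j((τ_{(2,2,3)} + 6)/7) = j(τ_{(98,-154,63)}) = j(τ_{(14,-22,9)}) = j(τ_{(1,0,5)})` (`D = -20`).
[cite: Cox2013, §11.B Lemma 11.24 and §11.A Thm. 11.2] -/
theorem conj_6_neg20' : kleinJ (divPoint 7 6 (heegnerTau (2, 2, 3))) = formJ (1, 0, 5) := by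
  have h := divPoint_seven_heegnerTau_of_pos (a := 2) (b := 2) (c := 3) (by norm_num) (by norm_num) 6
  norm_num at h
  have h7 := heegnerTau_seven_mul (a := 14) (b := -22) (c := 9) (by norm_num) (by norm_num)
  norm_num at h7
  rw [h, h7, ← formJ_eq_kleinJ]
  have e := formJ_eq_formJ_act ⟨14, -22, 9⟩ (by norm_num) (by norm_num [BinQF.disc]) (p := -1) (q := -2)
    (r := -1) (s := -3) (by norm_num)
  simpa [BinQF.act] using e

/-- **`Φ₇(j(τ_{(2,2,3)}), j(τ_{(1,0,5)})) = 0`** (`D = -20`), moduli as atoms `formJ`. [cite: Cox2013, §11.B (11.15) and Lemma 11.24] -/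
theorem rel_neg20 : (((intModularPolynomial 7).map (mapRingHom (Int.castRingHom ℂ))).map
    (evalRingHom (formJ (1, 0, 5)))).eval (formJ (2, 2, 3)) = 0 := by
  have h := intModularPolynomial_kleinJ_divPoint 7 3 (heegnerTau (1, 0, 5))
  rwa [conj_3_neg20, ← formJ_eq_kleinJ] at h

/-- **`Φ₇(j(τ_{(1,0,5)}), j(τ_{(2,2,3)})) = 0`** (`D = -20`), moduli as atoms `formJ`. [cite: Cox2013, §11.B (11.15) and Lemma 11.24] -/
theorem rel_neg20' : (((intModularPolynomial 7).map (mapRingHom (Int.castRingHom ℂ))).map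
    (evalRingHom (formJ (2, 2, 3)))).eval (formJ (1, 0, 5)) = 0 := by
  have h := intModularPolynomial_kleinJ_divPoint 7 2 (heegnerTau (2, 2, 3))
  rwa [conj_2_neg20', ← formJ_eq_kleinJ] at h

/-- **`∂Φ₇/∂X (j(τ_{(2,2,3)}), j(τ_{(1,0,5)})) = 0`** (`D = -20`): the cosets `k = 3, 4` of `τ_{(1,0,5)}` have the same
modulus, so `j(τ_{(2,2,3)})` is a DOUBLE root of the fibre over `j(τ_{(1,0,5)})`. [cite: Cox2013, §11.B (11.14)–(11.15) and Lemma 11.24] -/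
theorem drel_neg20 : (derivative (((intModularPolynomial 7).map (mapRingHom (Int.castRingHom ℂ))).map
    (evalRingHom (formJ (1, 0, 5))))).eval (formJ (2, 2, 3)) = 0 := by
  have h := derivative_fibre_eval_eq_zero_of_divPoint (p := 7) (k₁ := 3) (k₂ := 4) (τ := heegnerTau (1, 0, 5))
    (by norm_num) (by norm_num) (by norm_num) (conj_3_neg20.trans conj_4_neg20.symm)
  rwa [conj_3_neg20, ← formJ_eq_kleinJ] at h

/-- **`∂Φ₇/∂X (j(τ_{(1,0,5)}), j(τ_{(2,2,3)})) = 0`** (`D = -20`): the cosets `k = 2, 6` of `τ_{(2,2,3)}` have the same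
modulus, so `j(τ_{(1,0,5)})` is a DOUBLE root of the fibre over `j(τ_{(2,2,3)})`. [cite: Cox2013, §11.B (11.14)–(11.15) and Lemma 11.24] -/
theorem drel_neg20' : (derivative (((intModularPolynomial 7).map (mapRingHom (Int.castRingHom ℂ))).map
    (evalRingHom (formJ (2, 2, 3))))).eval (formJ (1, 0, 5)) = 0 := by
  have h := derivative_fibre_eval_eq_zero_of_divPoint (p := 7) (k₁ := 2) (k₂ := 6) (τ := heegnerTau (2, 2, 3))
    (by norm_num) (by norm_num) (by norm_num) (conj_2_neg20'.trans conj_6_neg20'.symm)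
  rwa [conj_2_neg20', ← formJ_eq_kleinJ] at h

/-! ### `D = -24`: forms `(1,0,6)` (principal) and `(2,0,3)` -/

/-- `j((τ_{(1,0,6)} + 1)/7) = j(τ_{(49,-14,7)}) = j(τ_{(7,-2,1)}) = j(τ_{(1,0,6)})` (`D = -24`).
[cite: Cox2013, §11.B Lemma 11.24 and §11.A Thm. 11.2] -/
theorem conj_1_neg24 : kleinJ (divPoint 7 1 (heegnerTau (1, 0, 6))) = formJ (1, 0, 6) := by
  have h := divPoint_seven_heegnerTau_of_pos (a := 1) (b := 0) (c := 6) one_pos (by norm_num) 1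
  norm_num at h
  have h7 := heegnerTau_seven_mul (a := 7) (b := -2) (c := 1) (by norm_num) (by norm_num)
  norm_num at h7
  rw [h, h7, ← formJ_eq_kleinJ]
  have e := formJ_eq_formJ_act ⟨7, -2, 1⟩ (by norm_num) (by norm_num [BinQF.disc]) (p := 0) (q := -1)
    (r := 1) (s := -1) (by norm_num)
  simpa [BinQF.act] using e

/-- `j((τ_{(1,0,6)} + 6)/7) = j(τ_{(49,-84,42)}) = j(τ_{(7,-12,6)}) = j(τ_{(1,0,6)})` (`D = -24`).
[cite: Cox2013, §11.B Lemma 11.24 and §11.A Thm. 11.2] -/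
theorem conj_6_neg24 : kleinJ (divPoint 7 6 (heegnerTau (1, 0, 6))) = formJ (1, 0, 6) := by
  have h := divPoint_seven_heegnerTau_of_pos (a := 1) (b := 0) (c := 6) one_pos (by norm_num) 6
  norm_num at h
  have h7 := heegnerTau_seven_mul (a := 7) (b := -12) (c := 6) (by norm_num) (by norm_num)
  norm_num at h7
  rw [h, h7, ← formJ_eq_kleinJ]
  have e := formJ_eq_formJ_act ⟨7, -12, 6⟩ (by norm_num) (by norm_num [BinQF.disc]) (p := -1) (q := 0)
    (r := -1) (s := -1) (by norm_num)
  simpa [BinQF.act] using e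

/-- `j((τ_{(2,0,3)} + 3)/7) = j(τ_{(98,-84,21)}) = j(τ_{(14,-12,3)}) = j(τ_{(2,0,3)})` (`D = -24`).
[cite: Cox2013, §11.B Lemma 11.24 and §11.A Thm. 11.2] -/
theorem conj_3_neg24' : kleinJ (divPoint 7 3 (heegnerTau (2, 0, 3))) = formJ (2, 0, 3) := by
  have h := divPoint_seven_heegnerTau_of_pos (a := 2) (b := 0) (c := 3) (by norm_num) (by norm_num) 3
  norm_num at h
  have h7 := heegnerTau_seven_mul (a := 14) (b := -12) (c := 3) (by norm_num) (by norm_num)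
  norm_num at h7
  rw [h, h7, ← formJ_eq_kleinJ]
  have e := formJ_eq_formJ_act ⟨14, -12, 3⟩ (by norm_num) (by norm_num [BinQF.disc]) (p := -1) (q := 0)
    (r := -2) (s := -1) (by norm_num)
  simpa [BinQF.act] using e

/-- `j((τ_{(2,0,3)} + 4)/7) = j(τ_{(98,-112,35)}) = j(τ_{(14,-16,5)}) = j(τ_{(2,0,3)})` (`D = -24`).
[cite: Cox2013, §11.B Lemma 11.24 and §11.A Thm. 11.2] -/
theorem conj_4_neg24' : kleinJ (divPoint 7 4 (heegnerTau (2, 0, 3))) = formJ (2, 0, 3) := by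
  have h := divPoint_seven_heegnerTau_of_pos (a := 2) (b := 0) (c := 3) (by norm_num) (by norm_num) 4
  norm_num at h
  have h7 := heegnerTau_seven_mul (a := 14) (b := -16) (c := 5) (by norm_num) (by norm_num)
  norm_num at h7
  rw [h, h7, ← formJ_eq_kleinJ]
  have e := formJ_eq_formJ_act ⟨14, -16, 5⟩ (by norm_num) (by norm_num [BinQF.disc]) (p := -1) (q := 1)
    (r := -2) (s := 1) (by norm_num)
  simpa [BinQF.act] using e

/-- **`Φ₇(j(τ_{(1,0,6)}), j(τ_{(1,0,6)})) = 0`** (`D = -24`), moduli as atoms `formJ`. [cite: Cox2013, §11.B (11.15) and Lemma 11.24] -/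
theorem rel_neg24 : (((intModularPolynomial 7).map (mapRingHom (Int.castRingHom ℂ))).map
    (evalRingHom (formJ (1, 0, 6)))).eval (formJ (1, 0, 6)) = 0 := by
  have h := intModularPolynomial_kleinJ_divPoint 7 1 (heegnerTau (1, 0, 6))
  rwa [conj_1_neg24, ← formJ_eq_kleinJ] at h

/-- **`Φ₇(j(τ_{(2,0,3)}), j(τ_{(2,0,3)})) = 0`** (`D = -24`), moduli as atoms `formJ`. [cite: Cox2013, §11.B (11.15) and Lemma 11.24] -/
theorem rel_neg24' : (((intModularPolynomial 7).map (mapRingHom (Int.castRingHom ℂ))).map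
    (evalRingHom (formJ (2, 0, 3)))).eval (formJ (2, 0, 3)) = 0 := by
  have h := intModularPolynomial_kleinJ_divPoint 7 3 (heegnerTau (2, 0, 3))
  rwa [conj_3_neg24', ← formJ_eq_kleinJ] at h

/-- **`∂Φ₇/∂X (j(τ_{(1,0,6)}), j(τ_{(1,0,6)})) = 0`** (`D = -24`): the cosets `k = 1, 6` of `τ_{(1,0,6)}` have the same
modulus, so `j(τ_{(1,0,6)})` is a DOUBLE diagonal zero at `j(τ_{(1,0,6)})`. [cite: Cox2013, §11.B (11.14)–(11.15) and Lemma 11.24] -/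
theorem drel_neg24 : (derivative (((intModularPolynomial 7).map (mapRingHom (Int.castRingHom ℂ))).map
    (evalRingHom (formJ (1, 0, 6))))).eval (formJ (1, 0, 6)) = 0 := by
  have h := derivative_fibre_eval_eq_zero_of_divPoint (p := 7) (k₁ := 1) (k₂ := 6) (τ := heegnerTau (1, 0, 6))
    (by norm_num) (by norm_num) (by norm_num) (conj_1_neg24.trans conj_6_neg24.symm)
  rwa [conj_1_neg24, ← formJ_eq_kleinJ] at h

/-- **`∂Φ₇/∂X (j(τ_{(2,0,3)}), j(τ_{(2,0,3)})) = 0`** (`D = -24`): the cosets `k = 3, 4` of `τ_{(2,0,3)}` have the same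
modulus, so `j(τ_{(2,0,3)})` is a DOUBLE diagonal zero at `j(τ_{(2,0,3)})`. [cite: Cox2013, §11.B (11.14)–(11.15) and Lemma 11.24] -/
theorem drel_neg24' : (derivative (((intModularPolynomial 7).map (mapRingHom (Int.castRingHom ℂ))).map
    (evalRingHom (formJ (2, 0, 3))))).eval (formJ (2, 0, 3)) = 0 := by
  have h := derivative_fibre_eval_eq_zero_of_divPoint (p := 7) (k₁ := 3) (k₂ := 4) (τ := heegnerTau (2, 0, 3))
    (by norm_num) (by norm_num) (by norm_num) (conj_3_neg24'.trans conj_4_neg24'.symm)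
  rwa [conj_3_neg24', ← formJ_eq_kleinJ] at h

/-! ### `D = -40`: forms `(1,0,10)` (principal) and `(2,0,5)` -/

/-- `j((τ_{(1,0,10)} + 2)/7) = j(τ_{(49,-28,14)}) = j(τ_{(7,-4,2)}) = j(τ_{(2,0,5)})` (`D = -40`).
[cite: Cox2013, §11.B Lemma 11.24 and §11.A Thm. 11.2] -/
theorem conj_2_neg40 : kleinJ (divPoint 7 2 (heegnerTau (1, 0, 10))) = formJ (2, 0, 5) := by
  have h := divPoint_seven_heegnerTau_of_pos (a := 1) (b := 0) (c := 10) one_pos (by norm_num) 2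
  norm_num at h
  have h7 := heegnerTau_seven_mul (a := 7) (b := -4) (c := 2) (by norm_num) (by norm_num)
  norm_num at h7
  rw [h, h7, ← formJ_eq_kleinJ]
  have e := formJ_eq_formJ_act ⟨7, -4, 2⟩ (by norm_num) (by norm_num [BinQF.disc]) (p := 0) (q := -1)
    (r := 1) (s := -1) (by norm_num)
  simpa [BinQF.act] using e

/-- `j((τ_{(1,0,10)} + 5)/7) = j(τ_{(49,-70,35)}) = j(τ_{(7,-10,5)}) = j(τ_{(2,0,5)})` (`D = -40`).
[cite: Cox2013, §11.B Lemma 11.24 and §11.A Thm. 11.2] -/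
theorem conj_5_neg40 : kleinJ (divPoint 7 5 (heegnerTau (1, 0, 10))) = formJ (2, 0, 5) := by
  have h := divPoint_seven_heegnerTau_of_pos (a := 1) (b := 0) (c := 10) one_pos (by norm_num) 5
  norm_num at h
  have h7 := heegnerTau_seven_mul (a := 7) (b := -10) (c := 5) (by norm_num) (by norm_num)
  norm_num at h7
  rw [h, h7, ← formJ_eq_kleinJ]
  have e := formJ_eq_formJ_act ⟨7, -10, 5⟩ (by norm_num) (by norm_num [BinQF.disc]) (p := -1) (q := 0)
    (r := -1) (s := -1) (by norm_num)
  simpa [BinQF.act] using e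

/-- `j((τ_{(2,0,5)} + 1)/7) = j(τ_{(98,-28,7)}) = j(τ_{(14,-4,1)}) = j(τ_{(1,0,10)})` (`D = -40`).
[cite: Cox2013, §11.B Lemma 11.24 and §11.A Thm. 11.2] -/
theorem conj_1_neg40' : kleinJ (divPoint 7 1 (heegnerTau (2, 0, 5))) = formJ (1, 0, 10) := by
  have h := divPoint_seven_heegnerTau_of_pos (a := 2) (b := 0) (c := 5) (by norm_num) (by norm_num) 1
  norm_num at h
  have h7 := heegnerTau_seven_mul (a := 14) (b := -4) (c := 1) (by norm_num) (by norm_num)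
  norm_num at h7
  rw [h, h7, ← formJ_eq_kleinJ]
  have e := formJ_eq_formJ_act ⟨14, -4, 1⟩ (by norm_num) (by norm_num [BinQF.disc]) (p := 0) (q := -1)
    (r := 1) (s := -2) (by norm_num)
  simpa [BinQF.act] using e

/-- `j((τ_{(2,0,5)} + 6)/7) = j(τ_{(98,-168,77)}) = j(τ_{(14,-24,11)}) = j(τ_{(1,0,10)})` (`D = -40`).
[cite: Cox2013, §11.B Lemma 11.24 and §11.A Thm. 11.2] -/
theorem conj_6_neg40' : kleinJ (divPoint 7 6 (heegnerTau (2, 0, 5))) = formJ (1, 0, 10) := by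
  have h := divPoint_seven_heegnerTau_of_pos (a := 2) (b := 0) (c := 5) (by norm_num) (by norm_num) 6
  norm_num at h
  have h7 := heegnerTau_seven_mul (a := 14) (b := -24) (c := 11) (by norm_num) (by norm_num)
  norm_num at h7
  rw [h, h7, ← formJ_eq_kleinJ]
  have e := formJ_eq_formJ_act ⟨14, -24, 11⟩ (by norm_num) (by norm_num [BinQF.disc]) (p := -1) (q := -1)
    (r := -1) (s := -2) (by norm_num)
  simpa [BinQF.act] using e

/-- **`Φ₇(j(τ_{(2,0,5)}), j(τ_{(1,0,10)})) = 0`** (`D = -40`), moduli as atoms `formJ`. [cite: Cox2013, §11.B (11.15) and Lemma 11.24] -/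
theorem rel_neg40 : (((intModularPolynomial 7).map (mapRingHom (Int.castRingHom ℂ))).map
    (evalRingHom (formJ (1, 0, 10)))).eval (formJ (2, 0, 5)) = 0 := by
  have h := intModularPolynomial_kleinJ_divPoint 7 2 (heegnerTau (1, 0, 10))
  rwa [conj_2_neg40, ← formJ_eq_kleinJ] at h

/-- **`Φ₇(j(τ_{(1,0,10)}), j(τ_{(2,0,5)})) = 0`** (`D = -40`), moduli as atoms `formJ`. [cite: Cox2013, §11.B (11.15) and Lemma 11.24] -/
theorem rel_neg40' : (((intModularPolynomial 7).map (mapRingHom (Int.castRingHom ℂ))).map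
    (evalRingHom (formJ (2, 0, 5)))).eval (formJ (1, 0, 10)) = 0 := by
  have h := intModularPolynomial_kleinJ_divPoint 7 1 (heegnerTau (2, 0, 5))
  rwa [conj_1_neg40', ← formJ_eq_kleinJ] at h

/-- **`∂Φ₇/∂X (j(τ_{(2,0,5)}), j(τ_{(1,0,10)})) = 0`** (`D = -40`): the cosets `k = 2, 5` of `τ_{(1,0,10)}` have the same
modulus, so `j(τ_{(2,0,5)})` is a DOUBLE root of the fibre over `j(τ_{(1,0,10)})`. [cite: Cox2013, §11.B (11.14)–(11.15) and Lemma 11.24] -/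
theorem drel_neg40 : (derivative (((intModularPolynomial 7).map (mapRingHom (Int.castRingHom ℂ))).map
    (evalRingHom (formJ (1, 0, 10))))).eval (formJ (2, 0, 5)) = 0 := by
  have h := derivative_fibre_eval_eq_zero_of_divPoint (p := 7) (k₁ := 2) (k₂ := 5) (τ := heegnerTau (1, 0, 10))
    (by norm_num) (by norm_num) (by norm_num) (conj_2_neg40.trans conj_5_neg40.symm)
  rwa [conj_2_neg40, ← formJ_eq_kleinJ] at h

/-- **`∂Φ₇/∂X (j(τ_{(1,0,10)}), j(τ_{(2,0,5)})) = 0`** (`D = -40`): the cosets `k = 1, 6` of `τ_{(2,0,5)}` have the same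
modulus, so `j(τ_{(1,0,10)})` is a DOUBLE root of the fibre over `j(τ_{(2,0,5)})`. [cite: Cox2013, §11.B (11.14)–(11.15) and Lemma 11.24] -/
theorem drel_neg40' : (derivative (((intModularPolynomial 7).map (mapRingHom (Int.castRingHom ℂ))).map
    (evalRingHom (formJ (2, 0, 5))))).eval (formJ (1, 0, 10)) = 0 := by
  have h := derivative_fibre_eval_eq_zero_of_divPoint (p := 7) (k₁ := 1) (k₂ := 6) (τ := heegnerTau (2, 0, 5))
    (by norm_num) (by norm_num) (by norm_num) (conj_1_neg40'.trans conj_6_neg40'.symm)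
  rwa [conj_1_neg40', ← formJ_eq_kleinJ] at h

end ModularPolynomialSeven
end Literature.NumberTheory.EllipticCurves
end
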